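import Literature.MathematicalPhysics.QuantumFieldTheory.ConformalBootstrap3D.PointKernelK57Data

/-!
# K57 certificate, kernel block file M1: (M) rows `25 ≤ j < 59` of `mrowsK57`, in 4 row groups

`decide` by kernel reduction of the (M) block checker `PCert.mBlockOK` of `PointKernel` on the literal
data of `PointKernelK57Data`; soundness is `PCert.mBlockOK_sound`.  Estimated kernel time 122 s.
-/

set_option maxRecDepth 100000
set_option maxHeartbeats 0

namespace Literature.MathematicalPhysics.QuantumFieldTheory.ConformalBootstrap3D.PointKernelK57

open Literature.MathematicalPhysics.QuantumFieldTheory.ConformalBootstrap3D.PointKernel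

/-- (M) rows `[25, 29)` pass the kernel evaluator. [folklore] -/
theorem mBlock_25 : certK57.mBlockOK mrowsK57 25 29 = true := by
  decide +kernel

/-- (M) rows `[29, 35)` pass the kernel evaluator. [folklore] -/
theorem mBlock_29 : certK57.mBlockOK mrowsK57 29 35 = true := by
  decide +kernel

/-- (M) rows `[35, 45)` pass the kernel evaluator. [folklore] -/
theorem mBlock_35 : certK57.mBlockOK mrowsK57 35 45 = true := by
  decide +kernel

/-- (M) rows `[45, 59)` pass the kernel evaluator. [folklore] -/
theorem mBlock_45 : certK57.mBlockOK mrowsK57 45 59 = true := by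
  decide +kernel

end Literature.MathematicalPhysics.QuantumFieldTheory.ConformalBootstrap3D.PointKernelK57
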